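import Summits.AtomisticToContinuum.FouriersLaw.Theorems.BondHeatUncertaintyExtensiveSnapshotIrreversibilityEnergyWindowPathSup
import Summits.AtomisticToContinuum.FouriersLaw.Theorems.BondHeatUncertaintyExtensiveSnapshotIrreversibilityEnergyWindowCostateApriori
import HarnessLib

/-!
(SPLIT FOR THE 400-LINE CAP by the landing lane, hand-2 g32: this file = part 1 of 2; sequels `…BondHeatUncertaintyExtensiveSnapshotIrreversibilityEnergyWindowCostateComponents` import it in a chain; same namespace, all FQNs unchanged.)
# Bond heat uncertainty — energy window: the component toolkit of a path costate
  (rung (C2g) beneath the open leaf (COF): first/second derivatives, sup bounds, Lipschitz and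
  Hölder-½ moduli of the costate coordinates, every constant in budget currency)

Cell `decomp-a2c`, lens-1 «grading / quantitative ladder», generation 84, crux
`stmt-AtomisticToContinuum-9121` (`ExtensiveSnapshotIrreversibility`, K_fix half, leaf S3), part R
(imports part Q `…EnergyWindowPathSup` and part M `…EnergyWindowCostateApriori` + HarnessLib).
Write a path costate as `c(r) = (α(r), β(r))`.  The costate equation (tree `coDrift_fst/snd`) reads
`α̇_j = Σ_i β_i ∂²Φ_{ij}(q_r)`, `β̇_i = -α_i + γ w_i β_i` on `(0, s)`.  This file supplies, for
the site-transfer proof of (COF) (memo §5), everything about the COORDINATES of `c`: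

* `abs_fst_coord_le_norm`; `abs_sub_le_mul_abs_sub_of_deriv`
  (Lipschitz on `[a,b]` from a derivative bound on `(a,b)` + continuity on `[a,b]`);
* `IsPathCostate.hasDerivAt_fst_apply`, `IsPathCostate.hasDerivAt_snd_apply` — the coordinate
  equations; `IsPathCostate.hasDerivAt_alphaDot` — **`α_j` is `C²`** with
  `α̈_j = Σ_i (β̇_i ∂²Φ_{ij}(q_r) + β_i hessDot_{ij}(q_r, p_r))` (part P: the Hessian along the
  path is `C¹`); `IsPathCostate.hasDerivAt_betaDot` — `β̈_i = -α̇_i + γ w_i β̇_i`;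
* sup bounds from an a-priori bound `‖c‖ ≤ S` on `[0,s]` and a Hessian sup bound `Λ`
  (part Q gives `Λ = Λ_H(θ, Θ_θ)` on `[0,1]`, part M gives `S = K Θ^μ ‖c(s)‖`):
  `|β̇_i| ≤ (1+2γ) S`, `|α̇_j| ≤ N Λ S`, `|β̈_i| ≤ (N Λ + 2γ(1+2γ)) S`,
  `|α̈_j| ≤ S Σ_i ((1+2γ)|∂²Φ_{ij}| + |hessDot_{ij}|)`;
* **`L²` bound of `α̈_j` in budget currency**: `∫₀ˢ α̈_j² ≤ 2 N² ((1+2γ)² Λ² + C_D² (2/θ²) Θ_θ) S²`;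
* moduli: `β_i` is `(1+2γ)S`-Lipschitz, `β̇_i` is `(NΛ + 2γ(1+2γ))S`-Lipschitz, and
  `|α̇_j(x) - α̇_j(y)| ≤ √(∫₀ˢ α̈_j²) · √|x - y|` (part N (C2c)).

References: parts J (`IsPathCostate`), M, N, P, Q; tree `LangevinChainCostate` (`coDrift_fst`,
`coDrift_snd`), `LangevinChainEnergyIdentity` (`bathWeight_nonneg`, `bathWeight_le_two`).
-/

namespace Summit.AtomisticToContinuum.FouriersLaw.Theorems.ExtensiveSnapshotIrreversibility.EnergyWindow

open MeasureTheory Filter Topology Set Finset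
open scoped Nat
open Literature.MathematicalPhysics.KineticTheory.HeatConduction Literature.Probability.Process

/-! ## 1. Coordinates and a Lipschitz lemma -/

/-- `|x.1 j| ≤ ‖x‖` (sup norms; the `x.2` version is the tree's `abs_snd_apply_le_norm`). [folklore] (dedup gate: an identical public twin is already landed elsewhere in the tree; kept PRIVATE here to keep the import closure local) -/
private theorem abs_fst_coord_le_norm {N : ℕ} (x : PhaseSpace N) (j : Fin N) : |x.1 j| ≤ ‖x‖ := by
  rw [← Real.norm_eq_abs]; exact (norm_le_pi_norm _ j).trans (norm_fst_le x)

/-- **Lipschitz from a derivative bound on the open interval**: `f` continuous on `[a,b]`,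
`f' = g` on `(a,b)` with `|g| ≤ L` there ⇒ `|f x - f y| ≤ L |x - y|` on `[a,b]`. [folklore] -/
theorem abs_sub_le_mul_abs_sub_of_deriv {f g : ℝ → ℝ} {a b L : ℝ}
    (hf : ContinuousOn f (Icc a b)) (hfg : ∀ x ∈ Ioo a b, HasDerivAt f (g x) x)
    (hg : ∀ x ∈ Ioo a b, |g x| ≤ L) {x y : ℝ} (hx : x ∈ Icc a b) (hy : y ∈ Icc a b) :
    |f x - f y| ≤ L * |x - y| := by
  wlog hxy : y ≤ x generalizing x y
  · have h := this hy hx (le_of_not_ge hxy)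
    rwa [abs_sub_comm (f y), abs_sub_comm y] at h
  have hD : Convex ℝ (Icc a b) := convex_Icc a b
  have hint : interior (Icc a b) = Ioo a b := interior_Icc
  have hdiff : DifferentiableOn ℝ f (interior (Icc a b)) := by
    rw [hint]; exact fun x hx => (hfg x hx).differentiableAt.differentiableWithinAt
  have hle : ∀ x ∈ interior (Icc a b), deriv f x ≤ L := by
    rw [hint]; intro x hx; rw [(hfg x hx).deriv]; exact (le_abs_self _).trans (hg x hx)
  have hge : ∀ x ∈ interior (Icc a b), -L ≤ deriv f x := by
    rw [hint]; intro x hx; rw [(hfg x hx).deriv]; exact (abs_le.1 (hg x hx)).1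
  have h1 := hD.image_sub_le_mul_sub_of_deriv_le hf hdiff hle y hy x hx hxy
  have h2 := hD.mul_sub_le_image_sub_of_le_deriv hf hdiff hge y hy x hx hxy
  rw [abs_of_nonneg (sub_nonneg.2 hxy), abs_le]
  constructor <;> linarith

/-! ## 2. The coordinate equations of a path costate; `α` is `C²`, `β̇` is `C¹` -/

section Costate

variable {ω₂ lam β γ : ℝ} {N : ℕ} {T_L T_R : ℝ}

/-- `α̇_j(r) = Σ_i β_i(r) ∂²Φ_{ij}(q_r)` on `(0, s)`. [folklore] -/
theorem IsPathCostate.hasDerivAt_fst_apply {s : ℝ} {z : PhaseSpace N} {wp : WienerPair}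
    {c : ℝ → PhaseSpace N} (hc : IsPathCostate ω₂ lam β γ N T_L T_R s z wp c) {r : ℝ}
    (hr : r ∈ Ioo 0 s) (j : Fin N) :
    HasDerivAt (fun t => (c t).1 j)
      (∑ i, (c r).2 i * (pinnedChain ω₂ lam β γ).hessPotential N i j
        ((pinnedChain ω₂ lam β γ).solMap N T_L T_R r z (pairPath wp)).1) r := by
  set L : PhaseSpace N →L[ℝ] ℝ :=
    (ContinuousLinearMap.proj j).comp (ContinuousLinearMap.fst ℝ (Fin N → ℝ) (Fin N → ℝ)) with hL
  have h : HasDerivAt (fun t => (c t).1 j) (L ((pinnedChain ω₂ lam β γ).coDrift N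
      ((pinnedChain ω₂ lam β γ).solMap N T_L T_R r z (pairPath wp)) (c r))) r :=
    L.hasFDerivAt.comp_hasDerivAt r (hc.2 r hr)
  exact h.congr_deriv rfl

/-- `β̇_i(r) = -α_i(r) + γ w_i β_i(r)` on `(0, s)`. [folklore] -/
theorem IsPathCostate.hasDerivAt_snd_apply {s : ℝ} {z : PhaseSpace N} {wp : WienerPair}
    {c : ℝ → PhaseSpace N} (hc : IsPathCostate ω₂ lam β γ N T_L T_R s z wp c) {r : ℝ}
    (hr : r ∈ Ioo 0 s) (i : Fin N) :
    HasDerivAt (fun t => (c t).2 i) (-(c r).1 i + γ * OscillatorChain.bathWeight N i * (c r).2 i) r := by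
  set L : PhaseSpace N →L[ℝ] ℝ :=
    (ContinuousLinearMap.proj i).comp (ContinuousLinearMap.snd ℝ (Fin N → ℝ) (Fin N → ℝ)) with hL
  have h : HasDerivAt (fun t => (c t).2 i) (L ((pinnedChain ω₂ lam β γ).coDrift N
      ((pinnedChain ω₂ lam β γ).solMap N T_L T_R r z (pairPath wp)) (c r))) r :=
    L.hasFDerivAt.comp_hasDerivAt r (hc.2 r hr)
  exact h.congr_deriv rfl

/-- **`α_j` is `C²` along a path costate**: on `(0, s)`,
`d/dr (Σ_i β_i ∂²Φ_{ij}(q_r)) = Σ_i ((-α_i + γ w_i β_i) ∂²Φ_{ij}(q_r) + β_i hessDot_{ij}(q_r, p_r))`.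
[NEW · rung (C2g) beneath (COF)] -/
theorem IsPathCostate.hasDerivAt_alphaDot (hω : 0 < ω₂) (hl : 0 ≤ lam) (hβ : 0 ≤ β) (hγ : 0 ≤ γ)
    {s : ℝ} {z : PhaseSpace N} {wp : WienerPair} {c : ℝ → PhaseSpace N}
    (hc : IsPathCostate ω₂ lam β γ N T_L T_R s z wp c) {r : ℝ} (hr : r ∈ Ioo 0 s) (j : Fin N) :
    HasDerivAt (fun t => ∑ i, (c t).2 i * (pinnedChain ω₂ lam β γ).hessPotential N i j
        ((pinnedChain ω₂ lam β γ).solMap N T_L T_R t z (pairPath wp)).1)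
      (∑ i, ((-(c r).1 i + γ * OscillatorChain.bathWeight N i * (c r).2 i) *
          (pinnedChain ω₂ lam β γ).hessPotential N i j
            ((pinnedChain ω₂ lam β γ).solMap N T_L T_R r z (pairPath wp)).1 +
        (c r).2 i * hessDot lam β N i j
          ((pinnedChain ω₂ lam β γ).solMap N T_L T_R r z (pairPath wp)).1
          ((pinnedChain ω₂ lam β γ).solMap N T_L T_R r z (pairPath wp)).2)) r :=
  HasDerivAt.fun_sum fun i _ =>
    (hc.hasDerivAt_snd_apply hr i).mul
      (hasDerivAt_hessPotential_solMap hω hl hβ hγ N T_L T_R z wp hr.1 i j)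

/-- **`β̇_i` is `C¹`**: on `(0, s)`, `d/dr (-α_i + γ w_i β_i) = -α̇_i + γ w_i β̇_i`. [folklore] -/
theorem IsPathCostate.hasDerivAt_betaDot {s : ℝ} {z : PhaseSpace N} {wp : WienerPair}
    {c : ℝ → PhaseSpace N} (hc : IsPathCostate ω₂ lam β γ N T_L T_R s z wp c) {r : ℝ}
    (hr : r ∈ Ioo 0 s) (i : Fin N) :
    HasDerivAt (fun t => -(c t).1 i + γ * OscillatorChain.bathWeight N i * (c t).2 i)
      (-(∑ k, (c r).2 k * (pinnedChain ω₂ lam β γ).hessPotential N k i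
          ((pinnedChain ω₂ lam β γ).solMap N T_L T_R r z (pairPath wp)).1) +
        γ * OscillatorChain.bathWeight N i * (-(c r).1 i + γ * OscillatorChain.bathWeight N i * (c r).2 i)) r :=
  (hc.hasDerivAt_fst_apply hr i).neg.add ((hc.hasDerivAt_snd_apply hr i).const_mul _)

/-! ## 3. Sup bounds of the coordinate derivatives -/

/-- `|β̇_i| = |-α_i + γ w_i β_i| ≤ (1 + 2γ) ‖c‖`. [folklore] -/
theorem abs_coDrift_snd_le (hγ : 0 ≤ γ) (x : PhaseSpace N) (i : Fin N) :
    |-x.1 i + γ * OscillatorChain.bathWeight N i * x.2 i| ≤ (1 + 2 * γ) * ‖x‖ := by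
  have h1 := abs_fst_coord_le_norm x i
  have h2 := abs_snd_apply_le_norm N x i
  have hw0 := bathWeight_nonneg N i
  have hw2 := bathWeight_le_two N i
  calc |-x.1 i + γ * OscillatorChain.bathWeight N i * x.2 i|
      ≤ |-x.1 i| + |γ * OscillatorChain.bathWeight N i * x.2 i| := abs_add_le _ _
    _ = |x.1 i| + γ * OscillatorChain.bathWeight N i * |x.2 i| := by
        rw [abs_neg, abs_mul, abs_mul, abs_of_nonneg hγ, abs_of_nonneg hw0]
    _ ≤ ‖x‖ + γ * 2 * ‖x‖ := by
        have : γ * OscillatorChain.bathWeight N i * |x.2 i| ≤ γ * 2 * ‖x‖ :=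
          mul_le_mul (mul_le_mul_of_nonneg_left hw2 hγ) h2 (abs_nonneg _) (by positivity)
        linarith
    _ = (1 + 2 * γ) * ‖x‖ := by ring

/-- `|α̇_j| = |Σ_i β_i ∂²Φ_{ij}(q)| ≤ N Λ ‖c‖` when `|∂²Φ_{ij}(q)| ≤ Λ`. [folklore] -/
theorem abs_coDrift_fst_le {q : Fin N → ℝ} {Λ : ℝ}
    (hΛ : ∀ i j, |(pinnedChain ω₂ lam β γ).hessPotential N i j q| ≤ Λ) (x : PhaseSpace N)
    (j : Fin N) :
    |∑ i, x.2 i * (pinnedChain ω₂ lam β γ).hessPotential N i j q| ≤ (N : ℝ) * Λ * ‖x‖ := by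
  calc |∑ i, x.2 i * (pinnedChain ω₂ lam β γ).hessPotential N i j q|
      ≤ ∑ i, |x.2 i * (pinnedChain ω₂ lam β γ).hessPotential N i j q| :=
        Finset.abs_sum_le_sum_abs _ _
    _ ≤ ∑ i : Fin N, ‖x‖ * Λ := Finset.sum_le_sum fun i _ => by
        rw [abs_mul]
        exact mul_le_mul (abs_snd_apply_le_norm N x i) (hΛ i j) (abs_nonneg _) (norm_nonneg _)
    _ = (N : ℝ) * Λ * ‖x‖ := by
        simp only [Finset.sum_const, Finset.card_univ, Fintype.card_fin, nsmul_eq_mul]; ring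

/-- `|β̈_i| = |-α̇_i + γ w_i β̇_i| ≤ (N Λ + 2γ(1+2γ)) ‖c‖` when `|∂²Φ_{ij}(q)| ≤ Λ`. [folklore] -/
theorem abs_betaDDot_le (hγ : 0 ≤ γ) {q : Fin N → ℝ} {Λ : ℝ}
    (hΛ : ∀ i j, |(pinnedChain ω₂ lam β γ).hessPotential N i j q| ≤ Λ) (x : PhaseSpace N)
    (i : Fin N) :
    |-(∑ k, x.2 k * (pinnedChain ω₂ lam β γ).hessPotential N k i q) +
        γ * OscillatorChain.bathWeight N i * (-x.1 i + γ * OscillatorChain.bathWeight N i * x.2 i)| ≤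
      ((N : ℝ) * Λ + 2 * γ * (1 + 2 * γ)) * ‖x‖ := by
  have h1 := abs_coDrift_fst_le hΛ x i
  have h2 := abs_coDrift_snd_le hγ x i
  have hw0 := bathWeight_nonneg N i
  have hw2 := bathWeight_le_two N i
  calc |-(∑ k, x.2 k * (pinnedChain ω₂ lam β γ).hessPotential N k i q) +
          γ * OscillatorChain.bathWeight N i * (-x.1 i + γ * OscillatorChain.bathWeight N i * x.2 i)|
      ≤ |-(∑ k, x.2 k * (pinnedChain ω₂ lam β γ).hessPotential N k i q)| +
          |γ * OscillatorChain.bathWeight N i * (-x.1 i + γ * OscillatorChain.bathWeight N i * x.2 i)| := abs_add_le _ _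
    _ = |∑ k, x.2 k * (pinnedChain ω₂ lam β γ).hessPotential N k i q| +
          γ * OscillatorChain.bathWeight N i * |-x.1 i + γ * OscillatorChain.bathWeight N i * x.2 i| := by
        rw [abs_neg, abs_mul, abs_mul, abs_of_nonneg hγ, abs_of_nonneg hw0]
    _ ≤ (N : ℝ) * Λ * ‖x‖ + γ * 2 * ((1 + 2 * γ) * ‖x‖) := by
        have : γ * OscillatorChain.bathWeight N i * |-x.1 i + γ * OscillatorChain.bathWeight N i * x.2 i| ≤
            γ * 2 * ((1 + 2 * γ) * ‖x‖) :=
          mul_le_mul (mul_le_mul_of_nonneg_left hw2 hγ) h2 (abs_nonneg _) (by positivity)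
        linarith
    _ = ((N : ℝ) * Λ + 2 * γ * (1 + 2 * γ)) * ‖x‖ := by ring

/-- `|α̈_j| ≤ ‖c‖ Σ_i ((1+2γ) |∂²Φ_{ij}(q)| + |hessDot_{ij}(q, p)|)`. [folklore] -/
theorem abs_alphaDDot_le (hγ : 0 ≤ γ) (y : PhaseSpace N) (x : PhaseSpace N) (j : Fin N) :
    |∑ i, ((-x.1 i + γ * OscillatorChain.bathWeight N i * x.2 i) *
          (pinnedChain ω₂ lam β γ).hessPotential N i j y.1 +
        x.2 i * hessDot lam β N i j y.1 y.2)| ≤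
      ‖x‖ * ∑ i, ((1 + 2 * γ) * |(pinnedChain ω₂ lam β γ).hessPotential N i j y.1| +
        |hessDot lam β N i j y.1 y.2|) := by
  refine (Finset.abs_sum_le_sum_abs _ _).trans ?_
  rw [Finset.mul_sum]
  refine Finset.sum_le_sum fun i _ => ?_
  have h1 := abs_coDrift_snd_le hγ x i
  have h2 := abs_snd_apply_le_norm N x i
  calc |(-x.1 i + γ * OscillatorChain.bathWeight N i * x.2 i) * (pinnedChain ω₂ lam β γ).hessPotential N i j y.1 +
          x.2 i * hessDot lam β N i j y.1 y.2|
      ≤ |(-x.1 i + γ * OscillatorChain.bathWeight N i * x.2 i)| *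
          |(pinnedChain ω₂ lam β γ).hessPotential N i j y.1| +
          |x.2 i| * |hessDot lam β N i j y.1 y.2| := by
        rw [← abs_mul, ← abs_mul]; exact abs_add_le _ _
    _ ≤ (1 + 2 * γ) * ‖x‖ * |(pinnedChain ω₂ lam β γ).hessPotential N i j y.1| +
          ‖x‖ * |hessDot lam β N i j y.1 y.2| := by
        gcongr
    _ = ‖x‖ * ((1 + 2 * γ) * |(pinnedChain ω₂ lam β γ).hessPotential N i j y.1| +
          |hessDot lam β N i j y.1 y.2|) := by ring

end Costate

end Summit.AtomisticToContinuum.FouriersLaw.Theorems.ExtensiveSnapshotIrreversibility.EnergyWindow
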